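import Summits.Langlands.Langlands.Theorems.PhantomRMYoshidaPhantomRMTransportSigma
import Summits.Langlands.Langlands.Theorems.PhantomRMYoshidaPhantomRMTransportDescent
import Summits.Langlands.Langlands.Theorems.PhantomRMYoshidaPhantomRMTransportEigenFrobenius
import Mathlib.LinearAlgebra.Matrix.NonsingularInverse
import Mathlib.LinearAlgebra.Matrix.ToLin
import Mathlib.LinearAlgebra.Matrix.Reindex

/-!
# Route `PhantomRMYoshida`, support item `PhantomRMTransport` (stmt-Langlands-13641):
# irreducibility of `σ` and `σ ≄ σ^(p)`

Helpers for the transport lemma `Summit.Langlands.Langlands.Theses.PhantomRMYoshida.PhantomRMTransport`.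
In the block frame `G = (e₀, e₁, F e₀, F e₁)` (file `…TransportBlock`) a matrix `Y` commuting with
all `S g ⊕ F(S g)` gives a matrix `G Y G⁻¹` commuting with `ρ̄(Γ) ⊗ k`, hence (commutant
`k + kΦ`, file `…TransportCommutant`) `Y = c + d (λ ⊕ λ ⊕ λ' ⊕ λ')` is block-*scalar*
(`exists_eq_fromBlocks_of_commute`).  Consequences: no `h` intertwines `S` with its Frobenius twist
(`not_exists_conj_frobenius`, take `Y = (0 0; h 0)`), and the commutant of `S(Γ)` is `k`
(`exists_eq_smul_one_of_commute_matrix`, take `Y = A ⊕ 0`).  Finally `σ` is irreducible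
(`isIrreducible_of_commutant`): a stable line gives a common eigenvector `w ∈ ker(Φ - λ)` of
`ρ̄(Γ)`; either `F² w ∉ k w`, and the projection onto `k w` along `k F²w` is a non-scalar
endomorphism of `S`, or `F² w ∈ k w`, and after rescaling `w` is `F²`-fixed, which the descent
lemma `false_of_fixed_common_eigenvector` (file `…TransportDescent`) forbids.
-/

set_option linter.dupNamespace false
set_option autoImplicit false

namespace Summit.Langlands.Langlands.Theorems.PhantomRMTransport

open Matrix Module

universe u v

section Blocks

variable {k : Type u} [Field k] {Γ : Type v}

/-- `reindex e e` is multiplicative. [folklore] -/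
theorem reindex_mul_reindex {m n : Type*} [Fintype m] [Fintype n] [DecidableEq m] [DecidableEq n]
    (e : m ≃ n) (A B : Matrix m m k) :
    Matrix.reindex e e A * Matrix.reindex e e B = Matrix.reindex e e (A * B) := by
  simp only [Matrix.reindex_apply, Matrix.submatrix_mul_equiv]

/-- **Block-scalar commutant in the frame `G`.** If the commutant of the `R g` is `k + kΦ`,
`R g G = G (D g)ʳ` and `Φ G = G (λ ⊕ λ')ʳ` (`ʳ` = reindexed along `e : m ⊕ m ≃ n`) with `G`
invertible, then every `Y` commuting with all `D g` is `c + d (λ ⊕ λ')` for some `c, d`.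
[folklore] -/
theorem exists_eq_fromBlocks_of_commute {m n : Type*} [Fintype m] [Fintype n] [DecidableEq m]
    [DecidableEq n] (e : m ⊕ m ≃ n) (R : Γ → Matrix n n k) {Φ : Matrix n n k} {lam lam' : k}
    (hcommk : ∀ X : Matrix n n k, (∀ g, X * R g = R g * X) → ∃ c d : k, X = c • 1 + d • Φ)
    {G : Matrix n n k} (hG : IsUnit G) {D : Γ → Matrix (m ⊕ m) (m ⊕ m) k}
    (hRG : ∀ g, R g * G = G * Matrix.reindex e e (D g))
    (hΦG : Φ * G = G * Matrix.reindex e e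
      (Matrix.fromBlocks (lam • (1 : Matrix m m k)) 0 0 (lam' • (1 : Matrix m m k))))
    (Y : Matrix (m ⊕ m) (m ⊕ m) k) (hY : ∀ g, Y * D g = D g * Y) :
    ∃ c d : k, Y = Matrix.fromBlocks ((c + d * lam) • (1 : Matrix m m k)) 0 0
      ((c + d * lam') • (1 : Matrix m m k)) := by
  have hGdet : IsUnit G.det := (Matrix.isUnit_iff_isUnit_det G).1 hG
  have hGG : G⁻¹ * G = 1 := Matrix.nonsing_inv_mul G hGdet
  have hGG' : G * G⁻¹ = 1 := Matrix.mul_nonsing_inv G hGdet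
  set Λ : Matrix (m ⊕ m) (m ⊕ m) k :=
    Matrix.fromBlocks (lam • (1 : Matrix m m k)) 0 0 (lam' • (1 : Matrix m m k)) with hΛ
  -- `X = G Yʳ G⁻¹` commutes with the `R g = G (D g)ʳ G⁻¹`
  set X : Matrix n n k := G * Matrix.reindex e e Y * G⁻¹ with hX
  have hR : ∀ g, R g = G * Matrix.reindex e e (D g) * G⁻¹ := fun g => by
    rw [← hRG, Matrix.mul_assoc, hGG', Matrix.mul_one]
  have hXR : ∀ g, X * R g = R g * X := by
    intro g
    rw [hR g, hX]
    calc G * Matrix.reindex e e Y * G⁻¹ * (G * Matrix.reindex e e (D g) * G⁻¹)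
        = G * (Matrix.reindex e e Y * (G⁻¹ * G) * Matrix.reindex e e (D g)) * G⁻¹ := by
          simp only [Matrix.mul_assoc]
      _ = G * (Matrix.reindex e e (D g) * (G⁻¹ * G) * Matrix.reindex e e Y) * G⁻¹ := by
          rw [hGG, Matrix.mul_one, Matrix.mul_one, reindex_mul_reindex, reindex_mul_reindex, hY]
      _ = G * Matrix.reindex e e (D g) * G⁻¹ * (G * Matrix.reindex e e Y * G⁻¹) := by
          simp only [Matrix.mul_assoc]
  obtain ⟨c, d, hcd⟩ := hcommk X hXR
  -- hence `Yʳ = G⁻¹ X G = c + d Λʳ`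
  have hYr : Matrix.reindex e e Y = c • 1 + d • Matrix.reindex e e Λ := by
    have h1 : G⁻¹ * X * G = Matrix.reindex e e Y := by
      rw [hX]
      calc G⁻¹ * (G * Matrix.reindex e e Y * G⁻¹) * G
          = (G⁻¹ * G) * Matrix.reindex e e Y * (G⁻¹ * G) := by simp only [Matrix.mul_assoc]
        _ = Matrix.reindex e e Y := by rw [hGG, Matrix.one_mul, Matrix.mul_one]
    have h2 : G⁻¹ * Φ * G = Matrix.reindex e e Λ := by
      rw [Matrix.mul_assoc, hΦG, ← Matrix.mul_assoc, hGG, Matrix.one_mul]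
    rw [← h1, hcd, Matrix.mul_add, Matrix.add_mul, Matrix.mul_smul, Matrix.mul_smul, Matrix.smul_mul,
      Matrix.smul_mul, Matrix.mul_one, hGG, h2]
  refine ⟨c, d, (Matrix.reindex e e).injective ?_⟩
  rw [hYr]
  -- `c + d Λ = ((c + dλ) ⊕ (c + dλ'))`, and `reindex` is linear with `reindex 1 = 1`
  have h3 : Matrix.fromBlocks ((c + d * lam) • (1 : Matrix m m k)) 0 0 ((c + d * lam') • 1) =
      c • (1 : Matrix (m ⊕ m) (m ⊕ m) k) + d • Λ := by
    rw [hΛ, ← Matrix.fromBlocks_one, Matrix.fromBlocks_smul, Matrix.fromBlocks_smul,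
      Matrix.fromBlocks_add]
    simp only [smul_zero, add_zero, add_smul, smul_smul]
  rw [h3]
  change c • 1 + d • Matrix.reindexLinearEquiv k k e e Λ =
    Matrix.reindexLinearEquiv k k e e (c • 1 + d • Λ)
  rw [map_add, map_smul, map_smul, Matrix.reindexLinearEquiv_one]

/-- **`σ ≄ σ^(p)`** in matrix form: no invertible `h` with `h · S g = F(S g) · h` for all `g`
(take `Y = (0 0; h 0)` in `exists_eq_fromBlocks_of_commute`). [folklore] -/
theorem not_exists_conj_frobenius {p : ℕ} [Fact p.Prime] [CharP k p] {m n : Type*} [Fintype m]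
    [Fintype n] [DecidableEq m] [DecidableEq n] [Nonempty m] (e : m ⊕ m ≃ n) (R : Γ → Matrix n n k)
    {Φ : Matrix n n k} {lam lam' : k}
    (hcommk : ∀ X : Matrix n n k, (∀ g, X * R g = R g * X) → ∃ c d : k, X = c • 1 + d • Φ)
    {G : Matrix n n k} (hG : IsUnit G) {S : Γ → Matrix m m k}
    (hRG : ∀ g, R g * G = G * Matrix.reindex e e
      (Matrix.fromBlocks (S g) 0 0 ((S g).map (frobenius k p))))
    (hΦG : Φ * G = G * Matrix.reindex e e
      (Matrix.fromBlocks (lam • (1 : Matrix m m k)) 0 0 (lam' • (1 : Matrix m m k)))) :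
    ¬ ∃ h : GL m k, ∀ g, (h : Matrix m m k) * S g = (S g).map (frobenius k p) * h := by
  rintro ⟨h, hh⟩
  have hY : ∀ g, Matrix.fromBlocks 0 0 (h : Matrix m m k) 0 *
      Matrix.fromBlocks (S g) 0 0 ((S g).map (frobenius k p)) =
      Matrix.fromBlocks (S g) 0 0 ((S g).map (frobenius k p)) * Matrix.fromBlocks 0 0 (h : Matrix m m k) 0 := by
    intro g
    simp only [Matrix.fromBlocks_multiply, Matrix.zero_mul, Matrix.mul_zero, add_zero, zero_add, hh g]
  obtain ⟨c, d, hcd⟩ := exists_eq_fromBlocks_of_commute e R hcommk hG hRG hΦG _ hY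
  have h0 : (h : Matrix m m k) = 0 := by
    have := (Matrix.fromBlocks_inj.1 hcd).2.2.1
    exact this
  exact Units.ne_zero h h0

/-- **The commutant of `S(Γ)` is `k`** (take `Y = A ⊕ 0` in `exists_eq_fromBlocks_of_commute`).
[folklore] -/
theorem exists_eq_smul_one_of_commute_matrix {m n : Type*} [Fintype m] [Fintype n] [DecidableEq m]
    [DecidableEq n] (e : m ⊕ m ≃ n) (R : Γ → Matrix n n k) {Φ : Matrix n n k} {lam lam' : k}
    (hcommk : ∀ X : Matrix n n k, (∀ g, X * R g = R g * X) → ∃ c d : k, X = c • 1 + d • Φ)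
    {G : Matrix n n k} (hG : IsUnit G) {S : Γ → Matrix m m k} {T : Γ → Matrix m m k}
    (hRG : ∀ g, R g * G = G * Matrix.reindex e e (Matrix.fromBlocks (S g) 0 0 (T g)))
    (hΦG : Φ * G = G * Matrix.reindex e e
      (Matrix.fromBlocks (lam • (1 : Matrix m m k)) 0 0 (lam' • (1 : Matrix m m k))))
    (A : Matrix m m k) (hA : ∀ g, A * S g = S g * A) : ∃ c : k, A = c • 1 := by
  have hY : ∀ g, Matrix.fromBlocks A 0 0 (0 : Matrix m m k) * Matrix.fromBlocks (S g) 0 0 (T g) =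
      Matrix.fromBlocks (S g) 0 0 (T g) * Matrix.fromBlocks A 0 0 0 := by
    intro g
    simp only [Matrix.fromBlocks_multiply, Matrix.zero_mul, Matrix.mul_zero, add_zero, hA g]
  obtain ⟨c, d, hcd⟩ := exists_eq_fromBlocks_of_commute e R hcommk hG hRG hΦG _ hY
  exact ⟨c + d * lam, (Matrix.fromBlocks_inj.1 hcd).1⟩

end Blocks

/-! ### Irreducibility of `σ` -/

section Irreducible

variable {p : ℕ} [Fact p.Prime] {k : Type u} [Field k] [CharP k p] [IsAlgClosed k]

/-- **`σ` is irreducible.** See the module docstring. [folklore] -/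
theorem isIrreducible_of_commutant (ι : ZMod p →+* k) {Γ : Type v} [Group Γ]
    (ρ : Γ →* GL (Fin 4) (ZMod p))
    (hirred : Representation.IsIrreducible
      ((Representation.ofDistribMulAction (ZMod p) (GL (Fin 4) (ZMod p)) (Fin 4 → ZMod p)).comp ρ))
    {R : Γ →* Matrix (Fin 4) (Fin 4) k}
    (hR : ∀ g, R g = ((ρ g : GL (Fin 4) (ZMod p)) : Matrix (Fin 4) (Fin 4) (ZMod p)).map ι)
    {Φ : Matrix (Fin 4) (Fin 4) k} (hΦf : Φ.map (frobenius k p) = Φ) {lam : k}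
    (hlamne : lam ^ p ≠ lam) (hlam2 : (lam ^ p) ^ p = lam)
    {e : Fin 2 → Fin 4 → k} (he : ∀ j, e j ∈ End.eigenspace (Matrix.toLin' Φ) lam)
    (hli : LinearIndependent k e)
    (hspan : End.eigenspace (Matrix.toLin' Φ) lam ≤ Submodule.span k (Set.range e))
    {S : Γ → Matrix (Fin 2) (Fin 2) k} (hS : ∀ g j, R g *ᵥ e j = ∑ i, S g i j • e i)
    (hEnd : ∀ A : Matrix (Fin 2) (Fin 2) k, (∀ g, A * S g = S g * A) → ∃ c : k, A = c • 1)
    (σ : Γ →* GL (Fin 2) k) (hσ : ∀ g, ((σ g : GL (Fin 2) k) : Matrix (Fin 2) (Fin 2) k) = S g) :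
    Representation.IsIrreducible
      ((Representation.ofDistribMulAction k (GL (Fin 2) k) (Fin 2 → k)).comp σ) := by
  classical
  set Rσ := (Representation.ofDistribMulAction k (GL (Fin 2) k) (Fin 2 → k)).comp σ with hRσ
  have hRσapp : ∀ g (v : Fin 2 → k), Rσ g v = S g *ᵥ v := fun g v => by rw [← hσ]; rfl
  have hRf : ∀ g (x : Fin 4 → k), frobenius k p ∘ (R g *ᵥ x) = R g *ᵥ (frobenius k p ∘ x) :=
    fun g x => by rw [frobenius_comp_mulVec, hR, map_frobenius_map_ringHom]
  -- the lattice of subrepresentations is nontrivial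
  have hbt : (⊥ : Subrepresentation Rσ) ≠ ⊤ := fun h => by
    have h' : (⊥ : Submodule k (Fin 2 → k)) = ⊤ := congrArg Subrepresentation.toSubmodule h
    exact bot_ne_top h'
  haveI : Nontrivial (Subrepresentation Rσ) := ⟨⟨⊥, ⊤, hbt⟩⟩
  refine ⟨fun N => ?_⟩
  by_contra hN
  push Not at hN
  obtain ⟨hNb, hNt⟩ := hN
  have hNb' : N.toSubmodule ≠ ⊥ := fun h =>
    hNb (Subrepresentation.toSubmodule_injective (by rw [h]; rfl))
  have hNt' : N.toSubmodule ≠ ⊤ := fun h =>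
    hNt (Subrepresentation.toSubmodule_injective (by rw [h]; rfl))
  -- `N` is a line `k v`
  obtain ⟨v, hvN, hv0⟩ := Submodule.exists_mem_ne_zero_of_ne_bot hNb'
  have hle : (k ∙ v) ≤ N.toSubmodule := (Submodule.span_singleton_le_iff_mem v _).2 hvN
  have hNeq : (k ∙ v) = N.toSubmodule := by
    refine Submodule.eq_of_le_of_finrank_eq hle ?_
    have h2 : finrank k N.toSubmodule < 2 := by
      have := Submodule.finrank_lt hNt'
      rwa [Module.finrank_fin_fun] at this
    have h1 : 1 ≤ finrank k N.toSubmodule := by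
      have := Submodule.finrank_mono hle
      rwa [finrank_span_singleton hv0] at this
    rw [finrank_span_singleton hv0]
    omega
  have heigv : ∀ g, ∃ χ : k, S g *ᵥ v = χ • v := fun g => by
    have h1 : Rσ g v ∈ (k ∙ v) := by rw [hNeq]; exact N.apply_mem_toSubmodule g hvN
    obtain ⟨χ, hχ⟩ := Submodule.mem_span_singleton.1 h1
    exact ⟨χ, by rw [← hRσapp, hχ]⟩
  -- the common eigenvector `w ∈ ker(Φ - λ)` of the `R g`
  set W := End.eigenspace (Matrix.toLin' Φ) lam with hW
  set w : Fin 4 → k := ∑ j, v j • e j with hw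
  have hwW : w ∈ W := Submodule.sum_mem _ fun j _ => Submodule.smul_mem _ _ (he j)
  have hw0 : w ≠ 0 := by
    intro h0
    apply hv0
    have h1 : ∑ j, v j • e j = ∑ j, (0 : Fin 2 → k) j • e j := by
      rw [← hw, h0]; simp
    exact eq_of_sum_smul_eq hli h1
  have heigw : ∀ g, ∃ χ : k, R g *ᵥ w = χ • w := fun g => by
    obtain ⟨χ, hχ⟩ := heigv g
    refine ⟨χ, ?_⟩
    rw [hw, mulVec_sum_smul_eq hS, hχ, Finset.smul_sum]
    simp only [Pi.smul_apply, smul_eq_mul, mul_smul]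
  -- `w₂ = F² w` is again a common eigenvector in `ker(Φ - λ)`
  set w₂ : Fin 4 → k := frobenius k p ∘ (frobenius k p ∘ w) with hw₂
  have hw₂W : w₂ ∈ W := by
    have h1 := frobenius_comp_mem_eigenspace hΦf (frobenius_comp_mem_eigenspace hΦf hwW)
    rwa [hlam2] at h1
  have hw₂0 : w₂ ≠ 0 := by
    intro h0
    rw [hw₂, frobenius_comp_eq_zero_iff, frobenius_comp_eq_zero_iff] at h0
    exact hw0 h0
  have heigw₂ : ∀ g, ∃ χ : k, R g *ᵥ w₂ = χ • w₂ := fun g => by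
    obtain ⟨χ, hχ⟩ := heigw g
    refine ⟨(χ ^ p) ^ p, ?_⟩
    rw [hw₂, ← hRf, ← hRf, hχ, frobenius_comp_smul, frobenius_comp_smul]
  by_cases hcase : ∃ μ : k, w₂ = μ • w
  · -- Case `F² w ∈ k w`: rescale to an `F²`-fixed vector and descend
    obtain ⟨μ, hμ⟩ := hcase
    have hμ0 : μ ≠ 0 := by
      rintro rfl
      rw [zero_smul] at hμ
      exact hw₂0 hμ
    have hp : 1 < p ^ 2 := by
      have := (Fact.out : p.Prime).one_lt
      nlinarith
    obtain ⟨t, ht0, ht⟩ := exists_ne_zero_pow_mul_eq μ hμ0 hp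
    refine false_of_fixed_common_eigenvector ι ρ hirred hlam2 hlamne (w₀ := t • w)
      (smul_ne_zero ht0 hw0) ?_ fun g => ?_
    · rw [frobenius_comp_smul, frobenius_comp_smul, ← hw₂, hμ, smul_smul, ← pow_mul, ← sq, ht]
    · obtain ⟨χ, hχ⟩ := heigw g
      refine ⟨χ, ?_⟩
      rw [← hR, Matrix.mulVec_smul, hχ, smul_comm]
  · -- Case `F² w ∉ k w`: the projection onto `k v` along `k v₂` commutes with `S` but is not scalar
    push Not at hcase
    obtain ⟨v₂, hv₂⟩ := (Submodule.mem_span_range_iff_exists_fun k).1 (hspan hw₂W)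
    have heigv₂ : ∀ g, ∃ χ : k, S g *ᵥ v₂ = χ • v₂ := fun g => by
      obtain ⟨χ, hχ⟩ := heigw₂ g
      refine ⟨χ, eq_of_sum_smul_eq hli ?_⟩
      rw [← mulVec_sum_smul_eq hS, hv₂, hχ]
      simp only [Pi.smul_apply, smul_eq_mul, mul_smul]
      rw [← Finset.smul_sum, hv₂]
    -- `v, v₂` are linearly independent
    have hli2 : LinearIndependent k ![v, v₂] := by
      refine LinearIndependent.pair_iff.2 fun s t hst => ?_
      have hsum : s • w + t • w₂ = 0 := by
        have h1 : ∑ j, (s • v + t • v₂) j • e j = s • w + t • w₂ := by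
          rw [hw, ← hv₂, Finset.smul_sum, Finset.smul_sum, ← Finset.sum_add_distrib]
          refine Finset.sum_congr rfl fun j _ => ?_
          simp only [Pi.add_apply, Pi.smul_apply, smul_eq_mul, add_smul, mul_smul]
        rw [← h1, hst]
        simp
      by_cases ht : t = 0
      · rw [ht, zero_smul, add_zero] at hsum
        exact ⟨(smul_eq_zero.1 hsum).resolve_right hw0, ht⟩
      · exfalso
        refine hcase (-(t⁻¹ * s)) ?_
        have : w₂ = t⁻¹ • (-(s • w)) := by
          rw [eq_inv_smul_iff₀ ht, eq_neg_iff_add_eq_zero, add_comm, hsum]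
        rw [this, smul_neg, smul_smul, neg_smul]
    -- the basis `(v, v₂)` of `k²` and the projection `A`
    have hcard : Fintype.card (Fin 2) = finrank k (Fin 2 → k) := by simp
    let bv : Basis (Fin 2) k (Fin 2 → k) := basisOfLinearIndependentOfCardEqFinrank hli2 hcard
    have hbv : ∀ i, bv i = ![v, v₂] i := fun i => by
      simp [bv, basisOfLinearIndependentOfCardEqFinrank]
    let Aₗ : (Fin 2 → k) →ₗ[k] (Fin 2 → k) := bv.constr k ![v, 0]
    have hA0 : Aₗ v = v := by
      have := bv.constr_basis k ![v, 0] 0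
      rwa [hbv 0] at this
    have hA1 : Aₗ v₂ = 0 := by
      have := bv.constr_basis k ![v, 0] 1
      rwa [hbv 1] at this
    have hcomm : ∀ g, Aₗ ∘ₗ Matrix.toLin' (S g) = Matrix.toLin' (S g) ∘ₗ Aₗ := by
      intro g
      refine bv.ext fun i => ?_
      obtain ⟨χ, hχ⟩ := heigv g
      obtain ⟨χ₂, hχ₂⟩ := heigv₂ g
      fin_cases i
      · simp only [LinearMap.comp_apply, Matrix.toLin'_apply, hbv]
        change Aₗ (S g *ᵥ v) = S g *ᵥ Aₗ v
        rw [hχ, map_smul, hA0, hχ]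
      · simp only [LinearMap.comp_apply, Matrix.toLin'_apply, hbv]
        change Aₗ (S g *ᵥ v₂) = S g *ᵥ Aₗ v₂
        rw [hχ₂, map_smul, hA1, smul_zero, Matrix.mulVec_zero]
    obtain ⟨c, hc⟩ := hEnd (LinearMap.toMatrix' Aₗ) fun g => by
      have := congrArg LinearMap.toMatrix' (hcomm g)
      rwa [LinearMap.toMatrix'_comp, LinearMap.toMatrix'_comp, LinearMap.toMatrix'_toLin'] at this
    have hAc : Aₗ = c • LinearMap.id := by
      apply LinearMap.toMatrix'.injective
      rw [hc, map_smul, LinearMap.toMatrix'_id]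
    have h1 : c = 1 := by
      have := hA0
      rw [hAc, LinearMap.smul_apply, LinearMap.id_apply] at this
      have h' : (c - 1) • v = 0 := by rw [sub_smul, this, one_smul, sub_self]
      exact sub_eq_zero.1 ((smul_eq_zero.1 h').resolve_right hv0)
    have h2 : c = 0 := by
      have := hA1
      rw [hAc, LinearMap.smul_apply, LinearMap.id_apply] at this
      have hv₂0 : v₂ ≠ 0 := by
        rintro rfl
        apply hw₂0
        rw [← hv₂]
        simp
      exact (smul_eq_zero.1 this).resolve_right hv₂0
    exact one_ne_zero (h1.symm.trans h2)

end Irreducible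

end Summit.Langlands.Langlands.Theorems.PhantomRMTransport
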